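import Summits.QuantumFields.YangMills.Theorems.BalabanUVNodesProp4AtRecordConeRadius
import Literature.MathematicalPhysics.QuantumFieldTheory.Balaban1983to89.B7
import HarnessLib

/-!
# [B7] PROP. 5 AT THE RECORD, BY NAME — the record instance `kexpOfRecord : KRecIdx F → B7.KExp` of [B7]'s abstract `k`-fold carrier and the door (KL-C) ⇐ `B7.Prop5Printed (kexpOfRecord F N)`:
# the one-bond coarse-column (on-cone entry) letter of `D C^{𝔰𝔩}` of ✓`…C44IterMhCone` ∕ ✓`…Prop4AtRecordConeRadius` REDUCED BY NAME to the typed fact `B7.Prop5Printed` (B7.lean :482)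

Cell `pub-ymgap` ∕ `ym-nodeO-ideate`, porter hand `hand-27238-KLC` (g0; director-ym R690-ym (1), ✦ plan g103 price (p2) = (d1)+(d2)); `--supports stmt-QuantumFields-27238 --as helper`; count-neutral.
[B7] = [Balaban1985Averaging]; [B11] = [Balaban1985Variational]; [RG1] = [Balaban1987RG1].  Dictionary memo: `Cruxes/Record13SepCoPHInhabitedAx/Lines/KLC-kexpOfRecord-hand.md`.

THE PRINT.  [B7] Prop. 5 p.42: «|(δ∕δA_b)Q_k(U₀, ηA, c)| ≦ 1 + 2C′₁α₀ + C₃|A| (156), |(δ∕δA_b)C_k(U₀, A, c)| ≦ C₃|A| (157)» for `U₀` with (52) «|U(∂p) − 1| < α₀η², η = L^{−k}» (p.26, p.40) and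
«U₁ = e^{iηA}, |A| < α₁», `A_b ∈ 𝔤ᶜ` (p.37, (109) p.34); (134) p.38 «Q_k(U₀, ηA) = Q_k(U₀)A + C_k(U₀, A)» (units `L^kη = 1`); (138) p.39 «the functional derivative coincides with partial derivatives
… multiplied by η^{−d}»; [B11] p.289 after (72): «the factor (L^jη)^{−d} comes from the change of scale: the derivative of C_j has the estimate (157) in [4] on L^{−j}-scale»; B7 p.20 ∕ RG1 p.253: the
propositions «can be easily extended to other definitions of averaging operations» ∕ «are valid universally for all averages satisfying the above properties» (the record's is RG1's (0.4)).

THE SIX-FIELD DICTIONARY (the fields `B7.Prop5Printed` READS; index `i = (K, k ≤ m+K, Ω, levB; c; b)` as lit's `B7ConclKExp.KIdx = (k; c; b)`):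
`Cfg := GaugeField (F.P K) 0 (SU N)` (print's `U₀` on the `η_k`-lattice `T^{(0)}`, values in `G = SU(N)`); `Fld := Bond d (sitesPerDir 0) → M_N(ℂ)` (print's `𝔤ᶜ`-valued `A`; D1: fibre `M_N(ℂ) ⊇ 𝔰𝔩(N, ℂ)`,
read through def-Y's traceless projection `P`, `C^{𝔰𝔩} = COfRecord ∘ P`); `plaqDevEta U₀ := η_k⁻²·⨆_p ‖U₀(∂p) − 1‖` ((52)); `fldNorm A := sup_b ‖A(b)‖` (print's `|A|`); `dQk U₀ A`, `dCk U₀ A :=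
η_k^{−d}·` the operator norm of `X ↦ (D Q^{𝔰𝔩}_k(U₀, η·)(A)·δ_b X)(c)`, resp. `X ↦ (D C^{𝔰𝔩}(A)·δ_b X)(c)` ((138)), `Q^{𝔰𝔩}_k(U₀, ηA) := C^{𝔰𝔩}(A) + Q_k(U₀)(PA)` ((134); `Q_k(U₀) = qCplxOp`).  Also print-faithful:
`k`, `remCk U₀ A := ‖C^{𝔰𝔩}(A)(c)‖` ((135)), `IsAnalyticQk` (Prop. 4's analyticity clause).  NOT MODELLED (read by Props. 6–7 only): `pert U₀ A′ := U₀` (NOT print's `U′U₀` (158) — an `SU(N)`-valued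
`Cfg` cannot host it), `avgRatioDev := 0`, `IsJointlyAnalytic := True` ⇒ `B7.Prop6Printed ∕ Prop7Printed (kexpOfRecord F N)` are NOT print's statements: DO NOT cite them for this family.
Located divergences (memo §2; none vacuous, none junk-false): D1 (the family's (157) at `(C₃, c₅)` follows from print's at `(C₃∕4, 2c₅)`: `|PA| ≤ 2|A|`, `‖πX‖ ≤ 2‖X‖`), D2 torus ∕ centred blocks,
D3 (0.4) `exp[mean log]` averaging vs B7's (14)–(15) (print asserts the extension, B7 p.20 ∕ RG1 p.253), D4 total functions with junk off the guards (`mlog`, `iterMh`, `fderiv`; every clause is guarded).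

WHAT THIS FILE PROVES (2 defs: `KRecIdx`, `kexpOfRecord`; unfolding `rfl`s; then glue):
§2 `plaqDevEta_lt_of_plaqSmall` ((52) ⇐ `PlaqSmall (αη_k²) U₀`, finite max), `pi_norm_le_norm115` (top level: `sup_b‖A(b)‖ ≤ ‖A‖₍₁₁₅₎`, weights `1` by ✓`levWeight_bondLevLit_eq_one`).
§3 ★ `entry_le_of_dCk_le` — `dCk U₀ A ≤ C₃|A|` IS `‖(D C^{𝔰𝔩}(A)·δ_b X)(c)‖ ≤ C₃η_k^d|A|‖X‖` (`le_opNorm`; [B11]'s «change of scale» at `j = k`).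
§4 ★★ `coneLetter_of_prop5Clause` — PT-B's on-cone entry letter `g₀ := C₃η_k^d` on `‖A‖ < α₁` (node-00: `k ≤ m + K`, `Ω_k = T`; (52) at `α₀`) from the (157) CLAUSE of `Prop5Printed`'s body at
   `(α₀, α₁, C₃)`; ★★★ `klC_of_B7Prop5Printed` — BY NAME: `B7.Prop5Printed (kexpOfRecord F N) → ∃ C₃ c₅ > 0, ∀ K k Ω U₀ levB …` = the `hg` binder of ✓`kernelLetterC_of_cone` ∕
   ✓`prop4UniformAtRecord_node00_of_coneLetter(_radius)` (constants before `K, k, U₀`; no cone antecedent needed — off the cone the entry is `0`, F9).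
§5 ★★ `kernelLetterC_of_prop5Clause` — G1's (KL-C) triple via ✓`kernelLetterC_of_cone`; ★★★ `prop4UniformAtRecord_node00_of_prop5Clause` — [B11] Prop. 4 (97)–(98) at the record (node-00, free
   radius) = ✓`prop4UniformAtRecord_node00_of_coneLetter_radius` with its (KL-C) block := the (157) clause (`2r′ ≤ α₁`, window `2r′·Θ_H·(2d·C₃η_k^d) ≤ ½`).  By-name use: `obtain ⟨C₁', C₃, c₅, -, hC₃,
   hc₅, h⟩ := h5` and `h157 := fun i U₀ hU A hA => (h i α α₁ hα hα5 hα₁ hα₁5 U₀ hU A hA).2`.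

HONEST FRAMING.  A typed INSTANCE + bookkeeping ((138) + `le_opNorm` + top-level weights); NO estimate of Bałaban is proved.  `B7.Prop5Printed (kexpOfRecord F N)` — [B7] Sect. D (139)–(155) for the
record's (0.4) averaging — is an UNPROVED printed statement used as a HYPOTHESIS (dictionary row (d3), XL, unowned; lit's ✓`B7ConclKExp.prop5Printed_K` proves the same typed statement for B7's
corner-block `ℤ^d` family only); (ℓa-H), (KL-H), (KL-N) ((R1)-class) and `‖J‖ ≤ nJ` stay DISPLAYED in §5; (R1)∕(R2) OPEN; K0ᴬ ⟨stmt-QuantumFields-27238⟩ NOT closed; K0ᴬ∕K1ᴬ∕K3ᴬ 0∕3; NODE O 0∕1; COUNT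
8∕28 · K 1∕4 UNMOVED; finite `𝕋⁴_{L^K}` at fixed ε — NOT continuum ∕ ℝ⁴ ∕ OS; **the Yang–Mills mass gap (Clay) is NOT proved by any of this.**  No `sorry`, `instance`, `notation`, `set_option`;
standard axioms.
-/

noncomputable section

open scoped Matrix Matrix.Norms.L2Operator InnerProductSpace ComplexConjugate BigOperators
open Classical

namespace Summit.QuantumFields.YangMills.Theorems.KExpOfRecord

open Literature.MathematicalPhysics.QuantumFieldTheory.Balaban1983to89
open Literature.MathematicalPhysics.QuantumFieldTheory.Balaban1983to89.Node00
open T4Continuum BlockAveraging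
open B10Eq42TorusConstraint (bondsIn)
open B9SectCLatticeCarrier (Bond)
open B11Eq103H1Complex (SiteL2K)
open B11Eq115Space (NegSup NegSize JetSup levWeight levWeight_apply)
open B11Eq90Transpose (single115)
open B11Eq90V0primeCurrent (flat115)
open B11Eq111FrakG (nabla115)

/-! ## §1  The index and the family -/

/-- **THE FAMILY INDEX** `i = (K, k, Ω, levB; c; b)`: the approximation `K` (torus `𝕋_{L^K}`), the order `k ≤ m + K` of the averaging (`η = η_k = L^{-k}`, the `k`-lattice
`T^{(k)}` is the unit lattice: `L^kη_k = 1`), the domain sequence `Ω` and target level map `levB` fixing the (115)-type carriers of the record's letter `C^{𝔰𝔩} = CslOfRecord`, a bond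
`c` of `T^{(k)} = Ω^{(k)}` at which `C_k(U₀, A, c)` is read, and a fine bond `b` (lit carrier) — the `δ/δA_b` of (156)–(157).  Family convention D-pv14.2 of `B7.lean`: `d = 4` and `L` are
fixed by `F`, the constants are chosen before `i`. [cite: Balaban1985Averaging, (127) p.37, (156)–(157) p.42] -/
structure KRecIdx (F : T4Family) where
  /-- the approximation index (`K` RG steps, torus `𝕋_{L^K}`) -/
  K : ℕ
  /-- the order `k` of the averaging (`η = L^{-k}`) -/
  k : ℕ
  /-- standing range of `Setup.Params` -/
  hk : k ≤ (F.P K).m + (F.P K).K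
  /-- the domain sequence fixing the level weights of the space (115) -/
  Ω : ℕ → Set (Site (F.P K) 0)
  /-- the level map of the target size `|·|_{(−0)}` on `T^{(k)}`-bonds -/
  levB : PBond (F.P K) k → ℕ
  /-- the bond `c ⊂ Ω^{(k)}` at which `Q_k(U₀, ηA, c)`, `C_k(U₀, A, c)` are read -/
  c : PBond (F.P K) k
  /-- the fine bond `b` of `δ/δA_b` (lit carrier `Bond d (sitesPerDir 0)`) -/
  b : Bond (F.P K).d (fun _ => (F.P K).sitesPerDir 0)

variable (F : T4Family) (N : ℕ) [NeZero N]

/-- ★★ **THE RECORD INSTANCE OF [B7]'s ABSTRACT `k`-FOLD CARRIER `B7.KExp`** at index `i = (K, k, Ω, levB; c; b)` — dictionary in the module docstring and the memo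
`Cruxes/Record13SepCoPHInhabitedAx/Lines/KLC-kexpOfRecord-hand.md`.  `Cfg` := `SU(N)`-valued configurations `U₀` on the `η_k`-lattice `T^{(0)}` of `F.P K`; `Fld` := `M_N(ℂ)`-valued bond fields
`A` on lit's carrier of `T^{(0)}`-bonds (print's `𝔤ᶜ`-valued `A`, `U₁ = e^{iηA}`; read on the slice by `C^{𝔰𝔩} = C ∘ P`); `k := k`; `plaqDevEta U₀ := η_k⁻²·sup_p |U₀(∂p) − 1|` ((52));
`fldNorm A := sup_b |A(b)|`; `remCk U₀ A := |C^{𝔰𝔩}(A)(c)|`; `dQk U₀ A`, `dCk U₀ A := η_k^{−d}·` the operator norm of `X ↦ (D Q^{𝔰𝔩}_k(U₀, η·)(A)·δ_b X)(c)`, resp. `X ↦ (D C^{𝔰𝔩}(A)·δ_b X)(c)`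
((137)–(138): functional derivative = partial derivative `× η^{−d}`), `Q^{𝔰𝔩}_k(U₀, ηA) := C^{𝔰𝔩}(A) + Q_k(U₀)(PA)` ((134), `L^kη = 1`); `IsAnalyticQk U₀ r` := analyticity of `A ↦ Q^{𝔰𝔩}_k(U₀, ηA)(c)` on
`{|A| < r}`.  NOT MODELLED (Props. 6–7 only): `pert U₀ A′ := U₀` (NOT print's `U′U₀` — an `SU(N)`-valued carrier cannot host it), `avgRatioDev := 0`, `IsJointlyAnalytic := True`; so
`B7.Prop6Printed ∕ Prop7Printed (kexpOfRecord F N)` are NOT print's statements and must not be cited for this family.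
[cite: Balaban1985Averaging, (52) p.26, (127) p.37, (134)–(135) pp.38–39, (137)–(138) p.39, Proposition 5 (156)–(157) p.42; Balaban1985Variational, (44) p.285, (51) p.286, (72) p.289] -/
def kexpOfRecord (i : KRecIdx F) : B7.KExp :=
  haveI : Fact (0 < (F.L : ℝ)) := factL F
  haveI : Fact (0 < (F.P i.K).eta i.k) := factEta F i.K i.k
  { Cfg := GaugeField (F.P i.K) 0 (SU N)
    Fld := Bond (F.P i.K).d (fun _ => (F.P i.K).sitesPerDir 0) → Matrix (Fin N) (Fin N) ℂ
    k := i.k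
    plaqDevEta := fun U₀ => ((F.P i.K).eta i.k ^ 2)⁻¹ * ⨆ p : Plaq (F.P i.K) 0, dist1 (GaugeField.plaqHol U₀ p)
    fldNorm := fun A => ‖A‖
    IsAnalyticQk := fun U₀ r =>
      AnalyticOnNhd ℂ
        (fun A' : Space115Lit F N i.K i.k i.Ω U₀ =>
          NegSup.equiv (levWeight (F.L : ℝ) ((F.P i.K).eta i.k) i.levB 0) (Matrix (Fin N) (Fin N) ℂ)
            (CslOfRecord F N i.K i.k i.Ω U₀ i.levB A' +
              (NegSup.equiv (levWeight (F.L : ℝ) ((F.P i.K).eta i.k) i.levB 0) (Matrix (Fin N) (Fin N) ℂ)).symm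
                (qCplxOp i.k U₀ (evLit F N i.K i.k i.Ω U₀ (slProjLit F N i.K i.k i.Ω U₀ A')))) i.c)
        {A' | ‖flat115 A'‖ < r}
    remCk := fun U₀ A =>
      ‖NegSup.equiv (levWeight (F.L : ℝ) ((F.P i.K).eta i.k) i.levB 0) (Matrix (Fin N) (Fin N) ℂ)
        (CslOfRecord F N i.K i.k i.Ω U₀ i.levB
          ((JetSup.equiv (levWeight (F.L : ℝ) ((F.P i.K).eta i.k) (bondLevLit F i.Ω i.k) 1) (levWeight (F.L : ℝ) ((F.P i.K).eta i.k) (pairLevLit F i.Ω i.k) 2)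
            (nabla115 ((F.P i.K).eta i.k) (unitsOfRecord F N U₀))).symm A)) i.c‖
    dQk := fun U₀ A =>
      ((F.P i.K).eta i.k ^ (F.P i.K).d)⁻¹ *
        ‖(NegSup.evalCLM ℂ (levWeight (F.L : ℝ) ((F.P i.K).eta i.k) i.levB 0) i.c).comp
          ((fderiv ℂ
              (fun A' : Space115Lit F N i.K i.k i.Ω U₀ =>
                CslOfRecord F N i.K i.k i.Ω U₀ i.levB A' +
                  (NegSup.equiv (levWeight (F.L : ℝ) ((F.P i.K).eta i.k) i.levB 0) (Matrix (Fin N) (Fin N) ℂ)).symm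
                    (qCplxOp i.k U₀ (evLit F N i.K i.k i.Ω U₀ (slProjLit F N i.K i.k i.Ω U₀ A'))))
              ((JetSup.equiv (levWeight (F.L : ℝ) ((F.P i.K).eta i.k) (bondLevLit F i.Ω i.k) 1) (levWeight (F.L : ℝ) ((F.P i.K).eta i.k) (pairLevLit F i.Ω i.k) 2)
                (nabla115 ((F.P i.K).eta i.k) (unitsOfRecord F N U₀))).symm A)).comp
            (single115 (lev₁ := pairLevLit F i.Ω i.k) (Dc := nabla115 ((F.P i.K).eta i.k) (unitsOfRecord F N U₀)) i.b))‖
    dCk := fun U₀ A =>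
      ((F.P i.K).eta i.k ^ (F.P i.K).d)⁻¹ *
        ‖(NegSup.evalCLM ℂ (levWeight (F.L : ℝ) ((F.P i.K).eta i.k) i.levB 0) i.c).comp
          ((fderiv ℂ (CslOfRecord F N i.K i.k i.Ω U₀ i.levB)
              ((JetSup.equiv (levWeight (F.L : ℝ) ((F.P i.K).eta i.k) (bondLevLit F i.Ω i.k) 1) (levWeight (F.L : ℝ) ((F.P i.K).eta i.k) (pairLevLit F i.Ω i.k) 2)
                (nabla115 ((F.P i.K).eta i.k) (unitsOfRecord F N U₀))).symm A)).comp
            (single115 (lev₁ := pairLevLit F i.Ω i.k) (Dc := nabla115 ((F.P i.K).eta i.k) (unitsOfRecord F N U₀)) i.b))‖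
    pert := fun U₀ _ => U₀
    avgRatioDev := fun _ _ => 0
    IsJointlyAnalytic := fun _ _ _ => True }

/-- Unfolding of the `dCk` field (`rfl`). [cite: Balaban1985Averaging, (157) p.42, (138) p.39 (bookkeeping)] -/
theorem kexpOfRecord_dCk (i : KRecIdx F) (U₀ : GaugeField (F.P i.K) 0 (SU N))
    (A : Bond (F.P i.K).d (fun _ => (F.P i.K).sitesPerDir 0) → Matrix (Fin N) (Fin N) ℂ) :
    haveI : Fact (0 < (F.L : ℝ)) := factL F
    haveI : Fact (0 < (F.P i.K).eta i.k) := factEta F i.K i.k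
    (kexpOfRecord F N i).dCk U₀ A =
      ((F.P i.K).eta i.k ^ (F.P i.K).d)⁻¹ *
        ‖(NegSup.evalCLM ℂ (levWeight (F.L : ℝ) ((F.P i.K).eta i.k) i.levB 0) i.c).comp
          ((fderiv ℂ (CslOfRecord F N i.K i.k i.Ω U₀ i.levB)
              ((JetSup.equiv (levWeight (F.L : ℝ) ((F.P i.K).eta i.k) (bondLevLit F i.Ω i.k) 1) (levWeight (F.L : ℝ) ((F.P i.K).eta i.k) (pairLevLit F i.Ω i.k) 2)
                (nabla115 ((F.P i.K).eta i.k) (unitsOfRecord F N U₀))).symm A)).comp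
            (single115 (lev₁ := pairLevLit F i.Ω i.k) (Dc := nabla115 ((F.P i.K).eta i.k) (unitsOfRecord F N U₀)) i.b))‖ := rfl

/-- Unfolding of the `fldNorm` field: print's `|A| = sup_b |A_b|` (`rfl`). [cite: Balaban1985Averaging, (110) p.35, (52) p.26 (bookkeeping)] -/
theorem kexpOfRecord_fldNorm (i : KRecIdx F) (A : Bond (F.P i.K).d (fun _ => (F.P i.K).sitesPerDir 0) → Matrix (Fin N) (Fin N) ℂ) :
    (kexpOfRecord F N i).fldNorm A = ‖A‖ := rfl

/-- Unfolding of the `plaqDevEta` field: `η_k⁻²·sup_p |U₀(∂p) − 1|` (`rfl`). [cite: Balaban1985Averaging, (52) p.26 (bookkeeping)] -/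
theorem kexpOfRecord_plaqDevEta (i : KRecIdx F) (U₀ : GaugeField (F.P i.K) 0 (SU N)) :
    (kexpOfRecord F N i).plaqDevEta U₀ = ((F.P i.K).eta i.k ^ 2)⁻¹ * ⨆ p : Plaq (F.P i.K) 0, dist1 (GaugeField.plaqHol U₀ p) := rfl


/-! ## §2  Two bookkeeping facts: (52) from `PlaqSmall`, and `sup_b |A(b)| ≤ ‖A‖₍₁₁₅₎` at the top level -/

/-- **(52) ⇐ THE RECORD's SMALL-FIELD PREDICATE**: `PlaqSmall (α·η_k²) U₀` (every `|U₀(∂p) − 1| < αη_k²`) and `0 < α` give `plaqDevEta U₀ < α` (finite maximum). [cite: Balaban1985Averaging, (52) p.26] -/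
theorem plaqDevEta_lt_of_plaqSmall (i : KRecIdx F) {α : ℝ} (hα : 0 < α) {U₀ : GaugeField (F.P i.K) 0 (SU N)}
    (hU : PlaqSmall (α * (F.P i.K).eta i.k ^ 2) U₀) : (kexpOfRecord F N i).plaqDevEta U₀ < α := by
  rw [kexpOfRecord_plaqDevEta]
  have hη : 0 < (F.P i.K).eta i.k ^ 2 := pow_pos (factEta F i.K i.k).out 2
  rw [inv_mul_lt_iff₀ hη]
  rcases isEmpty_or_nonempty (Plaq (F.P i.K) 0) with h | h
  · rw [Real.iSup_of_isEmpty]; positivity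
  · obtain ⟨p, hp⟩ := exists_eq_ciSup_of_finite (f := fun p : Plaq (F.P i.K) 0 => dist1 (GaugeField.plaqHol U₀ p))
    rw [← hp, mul_comm]
    exact hU p

variable {F N} in
omit [NeZero N] in
/-- **AT THE TOP LEVEL THE SUP NORM IS BELOW THE (115) NORM**: if every site lies in `Ω_k` the weights `(L^{j(b)}η_k)¹` are `1`, so `sup_b |A(b)| = |A|₍₋₁₎ ≤ max{|A|₍₋₁₎, |∇^{U₀}A|₍₋₂₎} = ‖A‖`.
[cite: Balaban1985Variational, (115) p.294, p.286] -/
theorem pi_norm_le_norm115 {K k : ℕ} {Ω : ℕ → Set (Site (F.P K) 0)} {U₀ : GaugeField (F.P K) 0 (SU N)} [Fact (0 < (F.L : ℝ))] [Fact (0 < (F.P K).eta k)]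
    (hΩ : ∀ x, x ∈ Ω k) (A : Space115Lit F N K k Ω U₀) :
    ‖JetSup.equiv (levWeight (F.L : ℝ) ((F.P K).eta k) (bondLevLit F Ω k) 1) (levWeight (F.L : ℝ) ((F.P K).eta k) (pairLevLit F Ω k) 2)
        (nabla115 ((F.P K).eta k) (unitsOfRecord F N U₀)) A‖ ≤ ‖A‖ := by
  refine (pi_norm_le_iff_of_nonneg (norm_nonneg A)).2 fun bb => ?_
  have h := JetSup.weight_mul_norm_apply_le A bb
  rwa [C44IterMh.levWeight_bondLevLit_eq_one F k Ω hΩ bb, one_mul] at h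

/-! ## §3  The entry step: `dCk ≤ C₃|A|` IS `‖(D C^{𝔰𝔩}(A)·δ_b X)(c)‖ ≤ C₃η^d·|A|·|X|` -/

variable {F N} in
/-- ★ **THE ENTRY STEP** ((137)–(138): partial derivative = `η^d ×` functional derivative): at index `i = (K, k, Ω, levB; c; b)`, the field bound `dCk U₀ A ≤ C₃·sup_b|A(b)|` IS the per-entry bound
`‖(D C^{𝔰𝔩}(A)·δ_b X)(c)‖ ≤ C₃η_k^d·sup_b|A(b)|·|X|` for every `X ∈ M_N(ℂ)` (operator norm, `le_opNorm`). [cite: Balaban1985Averaging, Proposition 5 (157) p.42, (137)–(138) p.39; Balaban1985Variational, (72) p.289] -/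
theorem entry_le_of_dCk_le {K k : ℕ} (hk : k ≤ (F.P K).m + (F.P K).K) {Ω : ℕ → Set (Site (F.P K) 0)} {U₀ : GaugeField (F.P K) 0 (SU N)} [Fact (0 < (F.L : ℝ))] [Fact (0 < (F.P K).eta k)]
    (levB : PBond (F.P K) k → ℕ) (c : PBond (F.P K) k) (bb : Bond (F.P K).d (fun _ => (F.P K).sitesPerDir 0)) {C₃ : ℝ} {A : Space115Lit F N K k Ω U₀}
    (h : (kexpOfRecord F N ⟨K, k, hk, Ω, levB, c, bb⟩).dCk U₀
        (JetSup.equiv (levWeight (F.L : ℝ) ((F.P K).eta k) (bondLevLit F Ω k) 1) (levWeight (F.L : ℝ) ((F.P K).eta k) (pairLevLit F Ω k) 2) (nabla115 ((F.P K).eta k) (unitsOfRecord F N U₀)) A) ≤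
      C₃ * ‖JetSup.equiv (levWeight (F.L : ℝ) ((F.P K).eta k) (bondLevLit F Ω k) 1) (levWeight (F.L : ℝ) ((F.P K).eta k) (pairLevLit F Ω k) 2) (nabla115 ((F.P K).eta k) (unitsOfRecord F N U₀)) A‖)
    (X : Matrix (Fin N) (Fin N) ℂ) :
    ‖NegSup.equiv (levWeight (F.L : ℝ) ((F.P K).eta k) levB 0) (Matrix (Fin N) (Fin N) ℂ)
        (fderiv ℂ (CslOfRecord F N K k Ω U₀ levB) A (single115 (lev₁ := pairLevLit F Ω k) (Dc := nabla115 ((F.P K).eta k) (unitsOfRecord F N U₀)) bb X)) c‖ ≤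
      C₃ * (F.P K).eta k ^ (F.P K).d *
        ‖JetSup.equiv (levWeight (F.L : ℝ) ((F.P K).eta k) (bondLevLit F Ω k) 1) (levWeight (F.L : ℝ) ((F.P K).eta k) (pairLevLit F Ω k) 2) (nabla115 ((F.P K).eta k) (unitsOfRecord F N U₀)) A‖ * ‖X‖ := by
  rw [kexpOfRecord_dCk] at h
  dsimp only at h
  rw [Equiv.symm_apply_apply] at h
  have hη : 0 < (F.P K).eta k ^ (F.P K).d := pow_pos Fact.out _
  rw [inv_mul_le_iff₀ hη] at h
  set T := (NegSup.evalCLM ℂ (levWeight (F.L : ℝ) ((F.P K).eta k) levB 0) c).comp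
    ((fderiv ℂ (CslOfRecord F N K k Ω U₀ levB) A).comp (single115 (lev₁ := pairLevLit F Ω k) (Dc := nabla115 ((F.P K).eta k) (unitsOfRecord F N U₀)) bb)) with hT
  have hTX : NegSup.equiv (levWeight (F.L : ℝ) ((F.P K).eta k) levB 0) (Matrix (Fin N) (Fin N) ℂ)
      (fderiv ℂ (CslOfRecord F N K k Ω U₀ levB) A (single115 (lev₁ := pairLevLit F Ω k) (Dc := nabla115 ((F.P K).eta k) (unitsOfRecord F N U₀)) bb X)) c = T X := rfl
  rw [hTX]
  calc ‖T X‖ ≤ ‖T‖ * ‖X‖ := T.le_opNorm X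
    _ ≤ ((F.P K).eta k ^ (F.P K).d * (C₃ * ‖JetSup.equiv (levWeight (F.L : ℝ) ((F.P K).eta k) (bondLevLit F Ω k) 1) (levWeight (F.L : ℝ) ((F.P K).eta k) (pairLevLit F Ω k) 2)
          (nabla115 ((F.P K).eta k) (unitsOfRecord F N U₀)) A‖)) * ‖X‖ := mul_le_mul_of_nonneg_right h (norm_nonneg X)
    _ = _ := by ring

/-! ## §4  (KL-C) — the on-cone entry letter of ✓`kernelLetterC_of_cone` ∕ ✓`prop4UniformAtRecord_node00_of_coneLetter(_radius)` — from the (157) clause, and BY NAME from `B7.Prop5Printed` -/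

/-- ★★ **(KL-C) FROM THE (157) CLAUSE OF `B7.Prop5Printed (kexpOfRecord F N)` AT FIXED CONSTANTS** (node-00 regime: `k ≤ m + K`, every site in `Ω_k`): if `U₀` satisfies (52) with `α₀`
(`PlaqSmall (α₀η_k²) U₀`, `0 < α₀`) and (157) holds over the family at `(α₀, α₁, C₃)`, then for EVERY `‖A‖ < α₁`, every fine bond `b`, `X ∈ M_N(ℂ)` and coarse bond `c`:
`‖(D C^{𝔰𝔩}(A)·δ_b X)(c)‖ ≤ C₃η_k^d·‖A‖·‖X‖` — the letter `g₀ := C₃η^d` of PT-B's cone door (which asks it only on the cone; off the cone the entry is `0`, F9).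
[cite: Balaban1985Averaging, Proposition 5 (157) p.42, (138) p.39; Balaban1985Variational, (72)–(73) p.289] -/
theorem coneLetter_of_prop5Clause {K k : ℕ} (hk : k ≤ (F.P K).m + (F.P K).K) {Ω : ℕ → Set (Site (F.P K) 0)} {U₀ : GaugeField (F.P K) 0 (SU N)}
    [Fact (0 < (F.L : ℝ))] [Fact (0 < (F.P K).eta k)] (levB : PBond (F.P K) k → ℕ) (hΩ : ∀ x, x ∈ Ω k) {C₃ α₀ α₁ : ℝ} (hC₃ : 0 ≤ C₃) (hα₀ : 0 < α₀)
    (h157 : ∀ (i : KRecIdx F) (U₀ : (kexpOfRecord F N i).Cfg), (kexpOfRecord F N i).plaqDevEta U₀ < α₀ →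
      ∀ A : (kexpOfRecord F N i).Fld, (kexpOfRecord F N i).fldNorm A < α₁ → (kexpOfRecord F N i).dCk U₀ A ≤ C₃ * (kexpOfRecord F N i).fldNorm A)
    (hU₀ : PlaqSmall (α₀ * (F.P K).eta k ^ 2) U₀) :
    ∀ A : Space115Lit F N K k Ω U₀, ‖A‖ < α₁ → ∀ (bb : Bond (F.P K).d (fun _ => (F.P K).sitesPerDir 0)) (X : Matrix (Fin N) (Fin N) ℂ) (c : PBond (F.P K) k),
      ‖NegSup.equiv (levWeight (F.L : ℝ) ((F.P K).eta k) levB 0) (Matrix (Fin N) (Fin N) ℂ)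
        (fderiv ℂ (CslOfRecord F N K k Ω U₀ levB) A (single115 (lev₁ := pairLevLit F Ω k) (Dc := nabla115 ((F.P K).eta k) (unitsOfRecord F N U₀)) bb X)) c‖ ≤
        C₃ * (F.P K).eta k ^ (F.P K).d * ‖A‖ * ‖X‖ := by
  intro A hA bb X c
  have hsup := pi_norm_le_norm115 (F := F) (N := N) hΩ A
  have hi := h157 ⟨K, k, hk, Ω, levB, c, bb⟩ U₀ (plaqDevEta_lt_of_plaqSmall F N ⟨K, k, hk, Ω, levB, c, bb⟩ hα₀ hU₀)
    (JetSup.equiv (levWeight (F.L : ℝ) ((F.P K).eta k) (bondLevLit F Ω k) 1) (levWeight (F.L : ℝ) ((F.P K).eta k) (pairLevLit F Ω k) 2) (nabla115 ((F.P K).eta k) (unitsOfRecord F N U₀)) A)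
    (by rw [kexpOfRecord_fldNorm]; exact lt_of_le_of_lt hsup hA)
  rw [kexpOfRecord_fldNorm] at hi
  have hη : 0 ≤ (F.P K).eta k ^ (F.P K).d := (pow_pos Fact.out _).le
  calc _ ≤ _ := entry_le_of_dCk_le hk levB c bb hi X
    _ ≤ C₃ * (F.P K).eta k ^ (F.P K).d * ‖A‖ * ‖X‖ := by gcongr

/-- ★★★ **(KL-C) BY NAME FROM `B7.Prop5Printed (kexpOfRecord F N)`** — [B7] PROP. 5 (157) FOR THE RECORD's (0.4) AVERAGING, read through the six-field dictionary of `kexpOfRecord`: there are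
`C₃, c₅ > 0` (print's `C₃ = 6C″₁` and its smallness threshold, chosen BEFORE `K, k, U₀`) such that for every approximation `K`, order `k ≤ m + K`, node-00 domain sequence (`Ω_k = T`),
background `U₀` with (52) at some `α₀ ≤ c₅`, radius `ρ ≤ c₅` and target weights `levB`: `‖(D C^{𝔰𝔩}(A)·δ_b X)(c)‖ ≤ C₃η_k^d·‖A‖·‖X‖` on `‖A‖ < ρ` — the `hg` input of ✓`kernelLetterC_of_cone` ∕
✓`prop4UniformAtRecord_node00_of_coneLetter(_radius)` with `g₀ := C₃η_k^d` (even without the cone antecedent).  HONEST: a reduction BY NAME; `B7.Prop5Printed (kexpOfRecord F N)` is an UNPROVED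
printed statement at the record (dictionary row (d3): its six fields vs print's `C_k(U₀, A, c)`, (52), `|A|`, `δ∕δA_b` — memo `Lines/KLC-kexpOfRecord-hand.md`); lit's ✓`B7ConclKExp.prop5Printed_K` proves the
same typed statement for the corner-block `ℤ^d` family only. [cite: Balaban1985Averaging, Proposition 5 (156)–(157) p.42, (52) p.26, (138) p.39; Balaban1985Variational, (72)–(73) p.289, (86) p.291] -/
theorem klC_of_B7Prop5Printed (h5 : B7.Prop5Printed (kexpOfRecord F N)) :
    ∃ C₃ c₅ : ℝ, 0 < C₃ ∧ 0 < c₅ ∧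
      ∀ (K k : ℕ) (hk : k ≤ (F.P K).m + (F.P K).K) (Ω : ℕ → Set (Site (F.P K) 0)) (U₀ : GaugeField (F.P K) 0 (SU N)) (levB : PBond (F.P K) k → ℕ)
        [Fact (0 < (F.L : ℝ))] [Fact (0 < (F.P K).eta k)], (∀ x, x ∈ Ω k) →
        ∀ ⦃α₀ : ℝ⦄, 0 < α₀ → α₀ ≤ c₅ → PlaqSmall (α₀ * (F.P K).eta k ^ 2) U₀ → ∀ ⦃ρ : ℝ⦄, ρ ≤ c₅ →
        ∀ A : Space115Lit F N K k Ω U₀, ‖A‖ < ρ → ∀ (bb : Bond (F.P K).d (fun _ => (F.P K).sitesPerDir 0)) (X : Matrix (Fin N) (Fin N) ℂ) (c : PBond (F.P K) k),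
          ‖NegSup.equiv (levWeight (F.L : ℝ) ((F.P K).eta k) levB 0) (Matrix (Fin N) (Fin N) ℂ)
            (fderiv ℂ (CslOfRecord F N K k Ω U₀ levB) A (single115 (lev₁ := pairLevLit F Ω k) (Dc := nabla115 ((F.P K).eta k) (unitsOfRecord F N U₀)) bb X)) c‖ ≤
            C₃ * (F.P K).eta k ^ (F.P K).d * ‖A‖ * ‖X‖ := by
  obtain ⟨C₁', C₃, c₅, -, hC₃, hc₅, h⟩ := h5
  refine ⟨C₃, c₅, hC₃, hc₅, fun K k hk Ω U₀ levB _ _ hΩ α₀ hα₀ hα₀5 hU₀ ρ hρ5 A hA bb X c => ?_⟩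
  have hρ : 0 < ρ := lt_of_le_of_lt (norm_nonneg A) hA
  exact coneLetter_of_prop5Clause F N hk levB hΩ hC₃.le hα₀ (fun i U₀' hU' A' hA' => (h i α₀ ρ hα₀ hα₀5 hρ hρ5 U₀' hU' A' hA').2) hU₀ A hA bb X c

/-! ## §5  Fed into PT-B's doors: G1's (KL-C) triple, and [B11] Prop. 4 at the record (node-00, free radius) -/

/-- ★★ **G1's (KL-C) TRIPLE FROM THE (157) CLAUSE** — ✓`kernelLetterC_of_cone` with its on-cone entry letter supplied by §4 (`g₀ := C₃η_k^d` on `‖A‖ < α₁`; the background's guard `SmallBelow` is the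
one F9 needs off the cone). [cite: Balaban1985Averaging, Proposition 5 (157) p.42, p.24; Balaban1985Variational, (73) p.289, (86) p.291] -/
theorem kernelLetterC_of_prop5Clause {K k : ℕ} (hk : k ≤ (F.P K).m + (F.P K).K) {Ω : ℕ → Set (Site (F.P K) 0)} {U₀ : GaugeField (F.P K) 0 (SU N)}
    [Fact (0 < (F.L : ℝ))] [Fact (0 < (F.P K).eta k)] (levB : PBond (F.P K) k → ℕ) (hΩ : ∀ x, x ∈ Ω k) (hsm : SmallBelow (avOfRecord F N K) k U₀)
    {C₃ α₀ α₁ : ℝ} (hC₃ : 0 ≤ C₃) (hα₀ : 0 < α₀)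
    (h157 : ∀ (i : KRecIdx F) (U₀ : (kexpOfRecord F N i).Cfg), (kexpOfRecord F N i).plaqDevEta U₀ < α₀ →
      ∀ A : (kexpOfRecord F N i).Fld, (kexpOfRecord F N i).fldNorm A < α₁ → (kexpOfRecord F N i).dCk U₀ A ≤ C₃ * (kexpOfRecord F N i).fldNorm A)
    (hU₀ : PlaqSmall (α₀ * (F.P K).eta k ^ 2) U₀) :
    (∀ (c : PBond (F.P K) k) (bb : Bond (F.P K).d (fun _ => (F.P K).sitesPerDir 0)),
      0 ≤ (if (bondToLit (F.P K) 0).symm bb ∈ bondsIn 0 {x : Site (F.P K) 0 | B14.Eq22Determines.blockIter k x = c.src ∨ B14.Eq22Determines.blockIter k x = c.tgt}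
        then C₃ * (F.P K).eta k ^ (F.P K).d else 0)) ∧
    (∀ A : Space115Lit F N K k Ω U₀, ‖A‖ < α₁ → ∀ (bb : Bond (F.P K).d (fun _ => (F.P K).sitesPerDir 0)) (X : Matrix (Fin N) (Fin N) ℂ) (c : PBond (F.P K) k),
      ‖NegSup.equiv (levWeight (F.L : ℝ) ((F.P K).eta k) levB 0) (Matrix (Fin N) (Fin N) ℂ)
        (fderiv ℂ (CslOfRecord F N K k Ω U₀ levB) A (single115 (lev₁ := pairLevLit F Ω k) (Dc := nabla115 ((F.P K).eta k) (unitsOfRecord F N U₀)) bb X)) c‖ ≤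
        (if (bondToLit (F.P K) 0).symm bb ∈ bondsIn 0 {x : Site (F.P K) 0 | B14.Eq22Determines.blockIter k x = c.src ∨ B14.Eq22Determines.blockIter k x = c.tgt}
          then C₃ * (F.P K).eta k ^ (F.P K).d else 0) * ‖A‖ * ‖X‖) ∧
    (∀ bb : Bond (F.P K).d (fun _ => (F.P K).sitesPerDir 0),
      (∑ c : PBond (F.P K) k, (if (bondToLit (F.P K) 0).symm bb ∈ bondsIn 0 {x : Site (F.P K) 0 | B14.Eq22Determines.blockIter k x = c.src ∨ B14.Eq22Determines.blockIter k x = c.tgt}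
        then C₃ * (F.P K).eta k ^ (F.P K).d else 0)) ≤ 2 * ((F.P K).d : ℝ) * (C₃ * (F.P K).eta k ^ (F.P K).d)) :=
  C44IterMh.kernelLetterC_of_cone F N K k Ω U₀ hk levB hsm (mul_nonneg hC₃ (pow_pos Fact.out _).le)
    fun A hA bb X c _ => coneLetter_of_prop5Clause F N hk levB hΩ hC₃ hα₀ h157 hU₀ A hA bb X c


section Prop4

variable (K k : ℕ) (Ω : ℕ → Set (Site (F.P K) 0)) (U₀ : GaugeField (F.P K) 0 (SU N))
variable [Fact (0 < (F.L : ℝ))] [Fact (0 < (F.P K).eta k)] [Fact (0 < c0Rec F K k)] [Fact (∀ c, 0 < wBRec F K k c)]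

/-- ★★★ **[B11] PROP. 4 (97)–(98) AT THE RECORD (NODE-00, FREE RADIUS) WITH ITS (KL-C) BLOCK := [B7] PROP. 5 (157) FOR THE RECORD** — PT-B's ✓`prop4UniformAtRecord_node00_of_coneLetter_radius` with the
on-cone entry letter supplied by §4 from the (157) clause of `B7.Prop5Printed (kexpOfRecord F N)` at constants `(α, α₁, C₃)` (`α` = the (14) tower's, so (52) for `U₀` is its `j = 0` member;
`2r′ ≤ α₁`): `g₀ := C₃η_k^d`, window `2r′·Θ_H·(2d·C₃η_k^d) ≤ ½` (met by shrinking `r′`).  Remaining DISPLAYED letters: (ℓa-H), (KL-H), (KL-N) ((R1)-class), `‖J‖ ≤ nJ`.  To use BY NAME: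
`obtain ⟨C₁', C₃, c₅, -, hC₃, hc₅, h⟩ := (h5 : B7.Prop5Printed (kexpOfRecord F N))` and pass `h157 := fun i U₀ hU A hA => (h i α α₁ hα hα5 hα₁ hα₁5 U₀ hU A hA).2` (`α, α₁ ≤ c₅`).  HONEST: glue; NO
estimate of [B7]∕[B9]∕[B11] is proved here. [cite: Balaban1985Variational, Prop. 4 (97)–(98) pp.292–293, (72)–(73) p.289, (86)–(89) p.291, (14) p.280; Balaban1985Averaging, Proposition 5 (157) p.42, (52) p.26, (138) p.39; Balaban1985BackgroundPropagators, (3.132) p.422] -/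
theorem prop4UniformAtRecord_node00_of_prop5Clause [DecidableEq (PBond (F.P K) k)] (levB : PBond (F.P K) k → ℕ) (a : ℝ)
    (hpos : ∀ x, x ≠ 0 → 0 < RCLike.re ⟪x, laplaceAOfRecord F N k U₀ (QOfRecord F N k U₀) (QflatOfRecord F N k) a x⟫_ℂ)
    (hQ : Function.Surjective (QOfRecord F N k U₀))
    (Gp : SiteL2K ℂ (F.P K).d (fun _ => (F.P K).sitesPerDir 0) (c0Rec F K k) (WRec N) →ₗ[ℂ]
      SiteL2K ℂ (F.P K).d (fun _ => (F.P K).sitesPerDir 0) (c0Rec F K k) (WRec N))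
    {b α nJ : ℝ} (hkpos : 0 < k) (hkm : k ≤ (F.P K).m + (F.P K).K) (hb : 0 ≤ b) (hΩ : ∀ x, x ∈ Ω k) (hαpos : 0 < α) (hα : α * (11000000 * N) ≤ 1)
    (hreg : ∀ j, j < k → PlaqSmall (α * ((F.L : ℝ) ^ j * (F.P K).eta k) ^ 2) (Averaging.iter (avOfRecord F N K) j U₀))
    (hH : Prop4LetterHAtRecord F N K k Ω U₀ levB a hpos hQ b)
    -- the radius
    {r' : ℝ} (hr'0 : 0 < r')
    (hr'le : letI C₂ : ℝ := 12800000000000000 * (F.L : ℝ) * N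
      letI c₄ : ℝ := 1 / (200000000000 * (F.L : ℝ) * N)
      r' ≤ min (c₄ / 4) (min (1 / 2) (1 / (16 * (b * C₂ + 1)))))
    -- (KL-H)
    {hk : Bond (F.P K).d (fun _ => (F.P K).sitesPerDir 0) → PBond (F.P K) k → ℝ} (hk0 : ∀ b' y, 0 ≤ hk b' y)
    (hHk : ∀ (y : PBond (F.P K) k) (Z : Matrix (Fin N) (Fin N) ℂ) (b' : Bond (F.P K).d (fun _ => (F.P K).sitesPerDir 0)),
      ‖flat115 (H1OfRecordAtBgFlat F N K k Ω U₀ levB a hpos hQ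
          ((NegSup.equiv (levWeight (F.L : ℝ) ((F.P K).eta k) levB 0) (Matrix (Fin N) (Fin N) ℂ)).symm (Pi.single y Z))) b'‖ ≤ hk b' y * ‖Z‖)
    {ΘH : ℝ} (hΘH : 0 ≤ ΘH) (hH1 : ∀ y, ∑ b', hk b' y ≤ ΘH) {ΘHw : ℝ} (hΘHw : 0 ≤ ΘHw)
    (hHw : ∀ (bb : Bond (F.P K).d (fun _ => (F.P K).sitesPerDir 0)) (y : PBond (F.P K) k),
      ∑ b', levWeight (F.L : ℝ) ((F.P K).eta k) (bondLevLit F Ω k) 3 bb / levWeight (F.L : ℝ) ((F.P K).eta k) (bondLevLit F Ω k) 3 b' * hk b' y ≤ ΘHw)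
    -- (KL-C) := the (157) clause of `B7.Prop5Printed (kexpOfRecord F N)` at `(α, α₁, C₃)`, `2r′ ≤ α₁`, and the window
    {C₃ α₁ : ℝ} (hC₃ : 0 ≤ C₃)
    (h157 : ∀ (i : KRecIdx F) (U₀ : (kexpOfRecord F N i).Cfg), (kexpOfRecord F N i).plaqDevEta U₀ < α →
      ∀ A : (kexpOfRecord F N i).Fld, (kexpOfRecord F N i).fldNorm A < α₁ → (kexpOfRecord F N i).dCk U₀ A ≤ C₃ * (kexpOfRecord F N i).fldNorm A)
    (hr'α₁ : r' + r' ≤ α₁)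
    (hq : (r' + r') * ΘH * (2 * ((F.P K).d : ℝ) * (C₃ * (F.P K).eta k ^ (F.P K).d)) ≤ 1 / 2)
    -- (KL-N)
    {hk' : Bond (F.P K).d (fun _ => (F.P K).sitesPerDir 0) → PBond (F.P K) k → ℝ} (hk'0 : ∀ b' y, 0 ≤ hk' b' y)
    (hNk : ∀ (y : PBond (F.P K) k) (Z : Matrix (Fin N) (Fin N) ℂ) (b' : Bond (F.P K).d (fun _ => (F.P K).sitesPerDir 0)),
      ‖NegSup.equiv (levWeight (F.L : ℝ) ((F.P K).eta k) (bondLevLit F Ω k) 3) (Matrix (Fin N) (Fin N) ℂ)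
        (DeltaPiCurOfRecord F N K k Ω U₀ Gp (QflatOfRecord F N k) (H1OfRecordAtBgFlat F N K k Ω U₀ levB a hpos hQ
          ((NegSup.equiv (levWeight (F.L : ℝ) ((F.P K).eta k) levB 0) (Matrix (Fin N) (Fin N) ℂ)).symm (Pi.single y Z)))) b'‖ ≤ hk' b' y * ‖Z‖)
    {Θ' : ℝ} (hΘ'0 : 0 ≤ Θ')
    (hΘ' : ∀ (bb : Bond (F.P K).d (fun _ => (F.P K).sitesPerDir 0)) (y : PBond (F.P K) k),
      ∑ b', levWeight (F.L : ℝ) ((F.P K).eta k) (bondLevLit F Ω k) 3 bb / levWeight (F.L : ℝ) ((F.P K).eta k) (bondLevLit F Ω k) 1 b' * hk' b' y ≤ Θ')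
    {N₁ : ℝ} (hN₁0 : 0 ≤ N₁)
    (hN₁ : ∀ b', ∑ y, levWeight (F.L : ℝ) ((F.P K).eta k) (bondLevLit F Ω k) 3 b' / levWeight (F.L : ℝ) ((F.P K).eta k) levB 0 y * hk' b' y ≤ N₁)
    (hJ : ‖JOfRecordAtBg F N K k Ω U₀‖ ≤ nJ) :
    letI C₂ : ℝ := 12800000000000000 * (F.L : ℝ) * N
    letI R' : ℝ := min r' ((1 - 4 * b * C₂ * (r' + r')) * (1 / 16))
    letI CV : ℝ := 1024 * (((F.P K).d - 1 : ℕ) : ℝ) * ((1 : ℝ) * 1) ^ 3 * N * (α * (1 : ℝ) ^ 2 + 1 / 16)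
        + (((F.P K).d - 1 : ℕ) : ℝ) * ((1 : ℝ) * 1) ^ 3 * (136 + 2 * ((1 : ℝ) * 1)) * N
    letI G : ℝ := 2 * ((F.P K).d : ℝ) * (C₃ * (F.P K).eta k ^ (F.P K).d)
    letI θ₃ : ℝ := (2 * (1 / (1 - 4 * b * C₂ * (r' + r'))) + 1) * ΘHw * G / r'
    letI θE : ℝ := 2 * ΘHw * G * (1 / (1 - 4 * b * C₂ * (r' + r')))
    letI θE' : ℝ := 2 * Θ' * G * (1 / (1 - 4 * b * C₂ * (r' + r')))
    Prop4UniformAtRecord F N K k Ω U₀ levB a hpos hQ r' Gp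
      ((N * θ₃ * nJ + (N₁ * C₂ * (1 / (1 - 4 * b * C₂ * (r' + r'))) ^ 2 + N * θE')
        + N * θE * (N₁ * C₂ * (1 / (1 - 4 * b * C₂ * (r' + r'))) ^ 2) * R'
        + N * (1 + θE * R') * CV * (1 / (1 - 4 * b * C₂ * (r' + r'))) ^ 2)) R' :=
  Prop4UniformAtRecord.prop4UniformAtRecord_node00_of_coneLetter_radius F N K k Ω U₀ levB a hpos hQ Gp hkpos hkm hb hΩ hαpos.le hα hreg hH hr'0 hr'le hk0 hHk hΘH hH1
    hΘHw hHw (mul_nonneg hC₃ (pow_pos Fact.out _).le)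
    (fun A hA bb X c _ => coneLetter_of_prop5Clause F N hkm levB hΩ hC₃ hαpos h157 (C44IterMh.plaqSmall_base_of_hreg F N U₀ hkpos hreg) A (lt_of_lt_of_le hA hr'α₁) bb X c)
    hq hk'0 hNk hΘ'0 hΘ' hN₁0 hN₁ hJ

end Prop4

end Summit.QuantumFields.YangMills.Theorems.KExpOfRecord

end
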